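import Summits.QuantumFields.GaugeBoot.TiltedBoxLimitSummary
import Summits.QuantumFields.GaugeBoot.TiltedBoxLimitClassBTwoDimAll
import HarnessLib

/-!
# Infinite-volume limit points of the 45°-tilted boxes, part 20: the two-dimensional summary

HONEST FRAMING (cell `pub-gaugeboot`, page 1 of every file): the venture produces certified bounds
on lattice expectations at stated coupling, gauge group, dimension and torus size; NOT a mass gap,
NOT a continuum limit, NOT a string tension; NOT Yang–Mills-summit-bearing (barriers
`FixedCouplingUltralocality`, `PerturbativeInvisibility`). One conjunction of the two-dimensional results
of parts 13–19 and of the four box-level positivity theorems, for citation; nothing new is proved.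

## Content

* **`inPlaneMirrors_twoDim_positive`** — on the square tilted boxes in two dimensions (`∀ k, k = i ∨ k = j`)
  ALL FOUR in-plane mirror classes are of positive type at EVERY real `β` for their natural half: the odd
  box's site mirror for the closed half `{0 ≤ x_i ≤ P}` (`tiltedBox_axisRP_odd_twoDim`), the even box's
  link mirror for `{1 ≤ x_i ≤ P}` (`tiltedBox_midAxisRP_twoDim`), the odd box's link mirror for the REDUCED
  half `{1 ≤ x_i ≤ P}` (`tiltedBox_midAxisRP_odd_twoDim`) and the even box's site mirror for the REDUCED half
  `{0 ≤ x_i ≤ P - 1}` (`tiltedBox_axisRP_even_twoDim`) — the two layer classes fail for the closed half at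
  every `β` (`inPlaneMirrors_twoDim`), in `d ≥ 3` all four fail for `β > 0` (`inPlaneMirrors_of_transverse_axis`).
* **`tiltedBoxLimitPoint_summary_two`** — every two-dimensional tilted limit point (`β ≥ 0`, compact
  Hausdorff second countable `G`, continuous `ρ`) is a translation-invariant DLR state with the Haar-shift
  identity, a Class-B state (`ClassBState`: every axis permutation and reflection, site / link / diagonal
  RP along every axis and plane), and anti-diagonal RP in the plane; `exists_classB_dlr_state_two`: such a
  state exists at every `β ≥ 0` (tilted boxes; no uniqueness hypothesis).

References: K. Osterwalder, E. Seiler, Ann. Phys. 110 (1978) 440, §2; J. Fröhlich, R. Israel, E. H. Lieb,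
B. Simon, J. Stat. Phys. 22 (1980) 297, §3; H.-O. Georgii (2011) Thm. 4.17; V. Kazakov, Z. Zheng,
arXiv:2203.11360 §3.1, arXiv:2404.16925 §3.2; A. A. Migdal, Sov. Phys. JETP 42 (1975) 413.
-/

noncomputable section

open MeasureTheory
open scoped ComplexOrder ComplexConjugate
open Literature.MathematicalPhysics.QuantumLattice

namespace Summit.QuantumFields.GaugeBoot

namespace TiltedRP

variable {d : ℕ} {i j : Fin d} {N : ℕ}
variable {G : Type*} [Group G] [TopologicalSpace G] [IsTopologicalGroup G] [CompactSpace G]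
  [MeasurableSpace G] [BorelSpace G] [SecondCountableTopology G]
variable (ρ : G →* Matrix (Fin N) (Fin N) ℂ)

/-! ## Box level: all four in-plane mirror classes are positive in two dimensions -/

/-- **In two dimensions all four in-plane mirror classes of the square tilted boxes are of positive type
for their natural half, at every real `β`** (`P ≥ 2`, `L ≥ 1`, `i ≠ j` exhausting the axes, every compact
second countable `G`, continuous `ρ`): (S1) odd box, site mirror, closed half `{0 ≤ x_i ≤ P}`; (S2) even box,
link mirror, closed half `{1 ≤ x_i ≤ P}`; (L2) odd box, link mirror, REDUCED half `{1 ≤ x_i ≤ P}`; (L1) even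
box, site mirror, REDUCED half `{0 ≤ x_i ≤ P - 1}`. Citation-only conjunction. -/
theorem inPlaneMirrors_twoDim_positive {L P : ℕ} [NeZero L] [NeZero P] (hij : i ≠ j)
    (hd : ∀ k : Fin d, k = i ∨ k = j) (hP : 2 ≤ P) (hρ : Continuous ρ) (β : ℝ) :
    (∀ F : Config (TiltedSite d i j (2 * P + 1) (2 * P + 1) L) d G → ℂ, Measurable F →
        (∃ C : ℝ, ∀ U, ‖F U‖ ≤ C) →
        IsHalfObservable (tiltedUnit d i j (2 * P + 1) (2 * P + 1) L) (2 * P + 1) (axisHeight2 d L (2 * P + 1)) F →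
        0 ≤ ∫ U, conj (F (configReflect (tiltedUnit d i j (2 * P + 1) (2 * P + 1) L) i
          (tiltedAxisFlip d L (2 * P + 1) hij) U)) * F U ∂(gibbs ρ (tiltedUnit d i j (2 * P + 1) (2 * P + 1) L) β)) ∧
    (∀ F : Config (TiltedSite d i j (2 * P) (2 * P) L) d G → ℂ, Measurable F → (∃ C : ℝ, ∀ U, ‖F U‖ ≤ C) →
        IsMidObservable (tiltedUnit d i j (2 * P) (2 * P) L) P (axisCoord d L (2 * P)) F →
        0 ≤ ∫ U, conj (F (configMidReflect (tiltedUnit d i j (2 * P) (2 * P) L) i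
          (tiltedAxisFlip d L (2 * P) hij) U)) * F U ∂(gibbs ρ (tiltedUnit d i j (2 * P) (2 * P) L) β)) ∧
    (∀ F : Config (TiltedSite d i j (2 * P + 1) (2 * P + 1) L) d G → ℂ, Measurable F →
        (∃ C : ℝ, ∀ U, ‖F U‖ ≤ C) →
        (∀ U V : Config (TiltedSite d i j (2 * P + 1) (2 * P + 1) L) d G, (∀ l, TwoDim.IsRedLink l → U l = V l) → F U = F V) →
        0 ≤ ∫ U, conj (F (configMidReflect (tiltedUnit d i j (2 * P + 1) (2 * P + 1) L) i
          (tiltedAxisFlip d L (2 * P + 1) hij) U)) * F U ∂(gibbs ρ (tiltedUnit d i j (2 * P + 1) (2 * P + 1) L) β)) ∧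
    (∀ F : Config (TiltedSite d i j (2 * P) (2 * P) L) d G → ℂ, Measurable F → (∃ C : ℝ, ∀ U, ‖F U‖ ≤ C) →
        (∀ U V : Config (TiltedSite d i j (2 * P) (2 * P) L) d G, (∀ l, TwoDim.IsRedSiteLink l → U l = V l) → F U = F V) →
        0 ≤ ∫ U, conj (F (configReflect (tiltedUnit d i j (2 * P) (2 * P) L) i
          (tiltedAxisFlip d L (2 * P) hij) U)) * F U ∂(gibbs ρ (tiltedUnit d i j (2 * P) (2 * P) L) β)) :=
  ⟨fun F hFm hFb hFo => TwoDim.tiltedBox_axisRP_odd_twoDim ρ hij hd hρ β F hFm hFb hFo,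
    fun F hFm hFb hFo => TwoDim.tiltedBox_midAxisRP_twoDim ρ hP hij hd hρ β F hFm hFb hFo,
    fun F hFm hFb hFo => TwoDim.tiltedBox_midAxisRP_odd_twoDim ρ hij hd hρ β F hFm hFb hFo,
    fun F hFm hFb hFo => TwoDim.tiltedBox_axisRP_even_twoDim ρ hP hij hd hρ β F hFm hFb hFo⟩

/-! ## Limit points: the two-dimensional summary -/

variable [T2Space G]

/-- **Summary, two dimensions: what every tilted limit point of `ℤ²` is** (`β ≥ 0`, `i ≠ j` exhausting the
axes): a translation-invariant DLR state of the Wilson action obeying the one-link Haar-shift identity, a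
CLASS-B state (invariant under every axis permutation and reflection; site, link and diagonal reflection
positive along every axis and in every plane), and reflection positive in the anti-diagonal `x_i + x_j = 0`. -/
theorem tiltedBoxLimitPoint_summary_two (hij : i ≠ j) (hd : ∀ k : Fin d, k = i ∨ k = j) (hρ : Continuous ρ)
    {β : ℝ} (hβ : 0 ≤ β) {μ : Measure (LGConfig d G)} (hμ : μ ∈ tiltedBoxLimitPoints d i j ρ β) :
    μ ∈ ymGibbsMeasuresTI ρ β ∧ IsHaarShiftState ρ β μ ∧
    (∃ ω : ClassBState d ρ β, ω.μ = μ) ∧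
    IsReflectionPositiveFor (configAntiDiagSwapZd (G := G) i j) (antiDiagHalfEdges i j) μ :=
  ⟨mem_ymGibbsMeasuresTI_of_mem_tiltedBoxLimitPoints ρ hρ hμ,
    isHaarShiftState_of_mem_tiltedBoxLimitPoints ρ hρ hμ,
    exists_classBState_eq_of_mem_tiltedBoxLimitPoints ρ hij hd hρ hβ hμ,
    antiDiagRP_of_mem_tiltedBoxLimitPoints ρ hij hρ hβ hμ⟩

/-- **In two dimensions a Class-B translation-invariant DLR state exists at every `β ≥ 0`**, unconditionally
(compact Hausdorff second countable `G`, continuous `ρ`): a tilted limit point. -/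
theorem exists_classB_dlr_state_two (hij : i ≠ j) (hd : ∀ k : Fin d, k = i ∨ k = j) (hρ : Continuous ρ)
    {β : ℝ} (hβ : 0 ≤ β) :
    ∃ ω : ClassBState d ρ β, ω.μ ∈ ymGibbsMeasuresTI ρ β ∧ ω.μ ∈ tiltedBoxLimitPoints d i j ρ β ∧
      IsReflectionPositiveFor (configAntiDiagSwapZd (G := G) i j) (antiDiagHalfEdges i j) ω.μ := by
  obtain ⟨μ, hμ⟩ := exists_tiltedBoxLimitPoint (d := d) (i := i) (j := j) ρ hρ β
  exact ⟨classBStateOfTilted ρ hij hd hρ hβ hμ, mem_ymGibbsMeasuresTI_of_mem_tiltedBoxLimitPoints ρ hρ hμ, hμ,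
    antiDiagRP_of_mem_tiltedBoxLimitPoints ρ hij hρ hβ hμ⟩

/-- **The statement on `ℤ²`, literally** (`d = 2`, axes `0`, `1`; `β ≥ 0`). -/
theorem tiltedBoxLimitPoint_summary_fin_two (hρ : Continuous ρ) {β : ℝ} (hβ : 0 ≤ β)
    {μ : Measure (LGConfig 2 G)} (hμ : μ ∈ tiltedBoxLimitPoints 2 (0 : Fin 2) 1 ρ β) :
    μ ∈ ymGibbsMeasuresTI ρ β ∧ IsHaarShiftState ρ β μ ∧
    (∃ ω : ClassBState 2 ρ β, ω.μ = μ) ∧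
    IsReflectionPositiveFor (configAntiDiagSwapZd (G := G) (0 : Fin 2) 1) (antiDiagHalfEdges (0 : Fin 2) 1) μ :=
  tiltedBoxLimitPoint_summary_two ρ Fin.zero_ne_one (fun k => by fin_cases k <;> simp) hρ hβ hμ

end TiltedRP

end Summit.QuantumFields.GaugeBoot

end
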